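import Summits.QuantumAdvantage.AdviceFreeQNC0.LiftCostFibres
import HarnessLib

/-!
# Cell qa-qnc0 (tensor line of crux α; rung R1U): `LiftOneU` from its fixed-gap instances
# (planner qa-qnc0-p2 ROUND-5 §5, support item `LiftOneUOfAt`)

Statements VERBATIM from qn-p2 `line/Sketch5.lean` (`LiftOneU`, `LiftOneUAt`, `LiftOneUOfAt`) and
PROVED: `liftOneU_of_at : LiftOneUOfAt` — R1U is the conjunction of its fixed-gap instances
`LiftOneUAt c K` with ONE constant `K` (the instances `L' < d` force `w = 0` and are trivial: `W = X`).

WHAT THIS IS NOT: no instance `LiftOneUAt c K` is proved here (qn-p2's THEOREMS E1–E3 are paper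
proofs); nothing on `TRPlus`, `RingToElim` or the separation.
-/

noncomputable section

namespace Summit.QuantumAdvantage.AdviceFreeQNC0

open Finset
open Literature.Computability.MetaComplexity Literature.Computability.MetaComplexity.Smolensky

/-! ### Vocabulary (verbatim from qn-p2 `line/Sketch5.lean`) -/

/-- **R1U** verbatim (qn-p2 `Sketch2.LiftOneU`): up to the unique-decoding radius (`2w ≤ 2^{L'-d}`)
the lift cost is `≤ K (d+2) w 2^L`. OPEN. -/
def LiftOneU : Prop :=
  ∃ K : ℝ, 0 < K ∧ ∀ L L' d w : ℕ, 2 * w ≤ 2 ^ (L' - d) →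
    ∀ X Y : BMat L L', LinCols X → RowsDeg d Y → (∀ u, rowDist X Y u ≤ w) →
      ∃ W : BMat L L', LinCols W ∧ RowsDeg d W ∧
        (hw (xorM X W) : ℝ) ≤ K * (d + 2) * w * (2 : ℝ) ^ L

/-- R1U at a FIXED gap `c = L' - d` (co-degree `e = c - 1`, `f = 2^c`) with constant `K`. -/
def LiftOneUAt (c : ℕ) (K : ℝ) : Prop :=
  ∀ L d w : ℕ, 2 * w ≤ 2 ^ c →
    ∀ X Y : BMat L (d + c), LinCols X → RowsDeg d Y → (∀ u, rowDist X Y u ≤ w) →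
      ∃ W : BMat L (d + c), LinCols W ∧ RowsDeg d W ∧
        (hw (xorM X W) : ℝ) ≤ K * (d + 2) * w * (2 : ℝ) ^ L

/-- bookkeeping (support): R1U is the conjunction of its fixed-gap instances with ONE constant
(the instances `L' < d` of `LiftOneU` force `w = 0` and are trivial). -/
def LiftOneUOfAt : Prop := (∃ K : ℝ, 0 < K ∧ ∀ c : ℕ, LiftOneUAt c K) → LiftOneU

/-! ### Proof -/

/-- Rows at distance `0` coincide. -/
theorem row_eq_of_rowDist_eq_zero {L L' : ℕ} {X Y : BMat L L'} {u : Fin L → Bool}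
    (h : rowDist X Y u = 0) : X u = Y u := by
  funext v
  unfold rowDist at h
  rw [Finset.card_eq_zero, Finset.filter_eq_empty_iff] at h
  have := h (Finset.mem_univ v)
  simpa using this

/-- `hw (X ⊕ X) = 0`. -/
theorem hw_xorM_self {L L' : ℕ} (X : BMat L L') : hw (xorM X X) = 0 := by
  unfold hw xorM
  rw [Finset.card_eq_zero, Finset.filter_eq_empty_iff]
  intro p _
  simp

/-- **`LiftOneUOfAt`.** -/
theorem liftOneU_of_at : LiftOneUOfAt := by
  rintro ⟨K, hK, hAt⟩
  refine ⟨K, hK, fun L L' d w hw2 X Y hX hY hdist => ?_⟩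
  by_cases hdL : d ≤ L'
  · -- the fixed-gap instance `c = L' - d`
    obtain ⟨c, rfl⟩ : ∃ c, L' = d + c := ⟨L' - d, by omega⟩
    rw [Nat.add_sub_cancel_left] at hw2
    exact hAt c L d w hw2 X Y hX hY hdist
  · -- `L' < d`: `w = 0`, the rows of `X` are those of `Y`, and `W = X` costs nothing
    have hL'd : L' - d = 0 := by omega
    rw [hL'd, pow_zero] at hw2
    have hw0 : w = 0 := by omega
    subst hw0
    refine ⟨X, hX, fun u => ?_, ?_⟩
    · have e : X u = Y u := row_eq_of_rowDist_eq_zero (Nat.le_zero.1 (hdist u))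
      have hYu := hY u
      rw [← e] at hYu
      exact hYu
    · rw [hw_xorM_self]
      simp

end Summit.QuantumAdvantage.AdviceFreeQNC0

end
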